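import Mathlib
import Summits.CriticalPhenomena.CardyFormulaZ2.Theorems.CardySelfRefinementDefs
import Summits.CriticalPhenomena.CardyFormulaZ2.Theorems.CardySelfRefinementRussoDriftModel
import Summits.CriticalPhenomena.CardyFormulaZ2.Theorems.CardySelfRefinementRussoDriftPolynomial
import Summits.CriticalPhenomena.CardyFormulaZ2.Theorems.CardySelfRefinementTrivialSectorRateStubOrbitAlignmentConditioning
import Literature.Probability.Percolation.BoundaryExplorerRevealment
import HarnessLib

/-!
# Helper (M4a), part 1, of stub `stub_fourArmAboveOne`, line `far-field-is-a-quarter-turn`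
(crux `TrivialSectorRate`, stmt-CriticalPhenomena-10266): the inside and the outside of an
ALIGNED block are independent under the dependent model `M_k`

Garban's block estimate `E[Z C_j] ≳ P[four arms at Q_j]` (Schramm–Smirnov 2011, App. B, (B.2)–(B.5);
tree: `le_integral_mul_circuitWeight`, `CrossingClusterBlockEstimate.lean`) rests on "FKG for the
conditional law inside `Q_j`" given the configuration outside `Q_j`, which for Bernoulli percolation
is the product law of the block.  The self-refinement law `M_k(ρ,c₀) = (coin product).map (cfg k)`
is NOT a product measure on bond configurations (the `k` sub-edges of a coarse edge read a common
shared coin and selector), but it IS decoupled across blocks whose corners lie on the coarse lattice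
`kℤ²`:

* `edgeOf_mem_blockPairs_of_tb_eq` — **alignment lemma**: if `k ∣ j i ± R` (`i = 0, 1`), an axial
  fine edge with the same coarse base and direction as an edge of `T = blockPairs j R` (all pairs of
  sites of `j + B(R)`) is itself in `T` — bundles do not straddle the boundary of an aligned block;
* `cfg_sdiff_eq_of_agree_off`, `cfg_sdiff_sdiff_coinWindow` — hence the configuration OFF `T` is a
  function of the coins OFF the coin window `coinWindow k T` (and the configuration ON `T` a function
  of the coins in the window, `cfg_inter_inter_coinWindow`, true for any `T`);
* `M_integral_eq_integral_integral` (registered helper) — **decoupling identity**: for every bounded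
  measurable `Φ`,
  `∫ Φ(ω ∩ T, ω ∖ T) dM_k(ω) = ∫∫ Φ(ω ∩ T, ω' ∖ T) dM_k(ω) dM_k(ω')`,
  i.e. `ω ∩ T` and `ω ∖ T` are independent under `M_k(ρ,c₀)` (the coins inside and outside the window
  are independent under the coin product, `prodBernoulli_map_inter_sdiff_eq_prod`, and Fubini).

This is the input of Harris's inequality inside the block given the outside for `M_k`
(file `…StubFourArmAboveOneCircuitBitsHarris.lean`) and of the block estimate for `M_k`
(file `…StubFourArmAboveOneCircuitBits.lean`).

References: O. Schramm, S. Smirnov (app. C. Garban), Ann. Probab. 39 (2011), App. B, proof of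
Lemma B.1; G. Grimmett, *Percolation* (1999), §2.2.

Target file:
`Summits/CriticalPhenomena/CardyFormulaZ2/Theorems/CardySelfRefinementTrivialSectorRateStubFourArmAboveOneCircuitBitsLocality.lean`.
-/

noncomputable section

namespace Summit.CriticalPhenomena.CardyFormulaZ2.Theorems.CardySelfRefinement.FarField

open Set MeasureTheory ProbabilityTheory
open Literature.Probability.LatticeModels Literature.Probability.Percolation
open Literature.Probability.Percolation.QuadCrossing
open Summit.CriticalPhenomena.CardyFormulaZ2.Theses.CardySelfRefinement

/-! ### Aligned blocks: the edges off the block read no coin of the block -/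

/-- Off-direction components of the direction vector vanish. -/
theorem dirVec_apply_of_ne {d i : Fin 2} (h : i ≠ d) : dirVec d i = 0 := by
  fin_cases d <;> fin_cases i <;> simp_all [dirVec]

/-- An axial edge has its off-direction coordinate divisible by `k`. -/
theorem dvd_apply_of_ax {k : ℕ} {v : Site 2} {d i : Fin 2} (hax : ax k (v, d)) (h : i ≠ d) :
    (k : ℤ) ∣ v i := by
  fin_cases d <;> fin_cases i <;> simp_all [ax]

/-- **Alignment lemma.**  If the block `j + B(R)` has its corners on the coarse lattice
(`k ∣ j i ± R`), an AXIAL fine edge with the same direction and coarse base as an edge of the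
block is itself an edge of the block (the bundle of a block edge lies in the block). -/
theorem edgeOf_mem_blockPairs_of_tb_eq {k : ℕ} (hk : 0 < k) {j : Site 2} {R : ℕ}
    (hal : ∀ i, (k : ℤ) ∣ j i - R ∧ (k : ℤ) ∣ j i + R) {vd vd' : Site 2 × Fin 2}
    (hax : ax k vd) (hvd' : edgeOf vd' ∈ blockPairs j R) (hd : vd.2 = vd'.2)
    (htb : tb k vd = tb k vd') : edgeOf vd ∈ blockPairs j R := by
  obtain ⟨v, d⟩ := vd
  obtain ⟨v', d'⟩ := vd'
  simp only at hd
  subst hd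
  have hk0 : (0 : ℤ) < k := by exact_mod_cast hk
  rw [mem_blockPairs_iff] at hvd' ⊢
  have h1 := mem_box.1 (hvd' v' (Sym2.mem_mk_left _ _))
  have h2 := mem_box.1 (hvd' (v' + dirVec d) (Sym2.mem_mk_right _ _))
  -- coordinatewise bounds for `v`
  have key : ∀ i, -(R : ℤ) ≤ v i - j i ∧ v i + dirVec d i - j i ≤ R := by
    intro i
    obtain ⟨a, ha⟩ := (hal i).1
    obtain ⟨b, hb⟩ := (hal i).2
    have h1i := h1 i
    have h2i := h2 i
    simp only [Pi.sub_apply, Pi.add_apply] at h1i h2i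
    have hqi : v i / (k : ℤ) = v' i / (k : ℤ) := congrFun htb i
    have e1 := Int.mul_ediv_add_emod (v i) k
    have e2 := Int.mul_ediv_add_emod (v' i) k
    have e3 := Int.emod_nonneg (v i) hk0.ne'
    have e4 := Int.emod_lt_of_pos (v i) hk0
    have e5 := Int.emod_nonneg (v' i) hk0.ne'
    have e6 := Int.emod_lt_of_pos (v' i) hk0
    -- `a ≤ v' i / k`
    have hqa : a ≤ v' i / k := by
      have hlt : (k : ℤ) * a < k * (v' i / k + 1) := by nlinarith
      have := lt_of_mul_lt_mul_left hlt hk0.le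
      omega
    have hka : (k : ℤ) * a ≤ k * (v i / k) := by
      rw [hqi]; exact Int.mul_le_mul_of_nonneg_left hqa hk0.le
    refine ⟨by nlinarith, ?_⟩
    by_cases hid : i = d
    · subst hid
      rw [dirVec_apply_self] at h2i ⊢
      -- `v' i / k + 1 ≤ b`
      have hqb : v' i / k + 1 ≤ b := by
        have hlt : (k : ℤ) * (v' i / k) < k * b := by nlinarith
        have := lt_of_mul_lt_mul_left hlt hk0.le
        omega
      have hkb : (k : ℤ) * (v i / k) + k ≤ k * b := by rw [hqi]; nlinarith
      nlinarith
    · rw [dirVec_apply_of_ne hid]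
      have hdv : (k : ℤ) * (v i / k) = v i := Int.mul_ediv_cancel' (dvd_apply_of_ax hax hid)
      nlinarith
  intro w hw
  rw [mem_box]
  rcases Sym2.mem_iff.1 hw with rfl | rfl
  · intro i
    obtain ⟨hlo, hhi⟩ := key i
    have h0 := dirVec_apply_nonneg d i
    simp only [Pi.sub_apply]
    constructor <;> linarith
  · intro i
    obtain ⟨hlo, hhi⟩ := key i
    have h0 := dirVec_apply_nonneg d i
    simp only [Pi.sub_apply, Pi.add_apply]
    constructor <;> linarith

/-- The own coin of an edge off `W` is not read through `W`. -/
theorem own_not_mem_coinWindow (k : ℕ) {W : Set (Sym2 (Site 2))} {vd : Site 2 × Fin 2}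
    (h : edgeOf vd ∉ W) : (vd.1, vd.2, (0 : Fin 3)) ∉ coinWindow k W := by
  intro hi
  obtain ⟨vd', hvd', hi'⟩ := Set.mem_iUnion₂.1 hi
  obtain ⟨v', d'⟩ := vd'
  obtain ⟨v, d⟩ := vd
  simp only [coinsOf, Set.mem_insert_iff, Set.mem_singleton_iff, Prod.mk.injEq] at hi'
  rcases hi' with ⟨h1, h2, -⟩ | ⟨-, -, h3⟩ | ⟨-, -, h3⟩
  · subst h1; subst h2; exact h hvd'
  · exact absurd h3 (by decide)
  · exact absurd h3 (by decide)

/-- For an aligned block, the shared coin and the selector of the bundle of an AXIAL edge off the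
block are not read through the block. -/
theorem bundle_not_mem_coinWindow {k : ℕ} (hk : 0 < k) {j : Site 2} {R : ℕ}
    (hal : ∀ i, (k : ℤ) ∣ j i - R ∧ (k : ℤ) ∣ j i + R) {vd : Site 2 × Fin 2} (hax : ax k vd)
    (h : edgeOf vd ∉ (↑(blockPairs j R) : Set (Sym2 (Site 2)))) {l : Fin 3} (hl : l ≠ 0) :
    (tb k vd, vd.2, l) ∉ coinWindow k (↑(blockPairs j R) : Set (Sym2 (Site 2))) := by
  intro hi
  obtain ⟨vd', hvd', hi'⟩ := Set.mem_iUnion₂.1 hi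
  have htb : tb k vd = tb k vd' ∧ vd.2 = vd'.2 := by
    obtain ⟨v', d'⟩ := vd'
    simp only [coinsOf, Set.mem_insert_iff, Set.mem_singleton_iff, Prod.mk.injEq] at hi'
    rcases hi' with ⟨-, -, h3⟩ | ⟨h1, h2, -⟩ | ⟨h1, h2, -⟩
    · exact absurd h3 hl
    · exact ⟨h1, h2⟩
    · exact ⟨h1, h2⟩
  exact h (edgeOf_mem_blockPairs_of_tb_eq hk hal hax hvd' htb.2 htb.1)

/-- **Coins agreeing OFF the coin window of an aligned block give configurations agreeing OFF the
block**: an edge off the block reads its own coin (never in the window) and, if axial, the two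
coins of its bundle, which by the alignment lemma is a bundle off the block. -/
theorem cfg_sdiff_eq_of_agree_off {k : ℕ} (hk : 0 < k) {j : Site 2} {R : ℕ}
    (hal : ∀ i, (k : ℤ) ∣ j i - R ∧ (k : ℤ) ∣ j i + R) {S S' : Set Coin}
    (h : ∀ i ∉ coinWindow k (↑(blockPairs j R) : Set (Sym2 (Site 2))), (i ∈ S ↔ i ∈ S')) :
    cfg k S \ (↑(blockPairs j R) : Set (Sym2 (Site 2))) = cfg k S' \ ↑(blockPairs j R) := by
  have key : ∀ (v : Site 2) (d : Fin 2), edgeOf (v, d) ∉ (↑(blockPairs j R) : Set (Sym2 (Site 2))) →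
      (opn k S (v, d) ↔ opn k S' (v, d)) := by
    intro v d he
    have h0 := h _ (own_not_mem_coinWindow k he)
    simp only [opn]
    split_ifs with hax
    · have h1 := h _ (bundle_not_mem_coinWindow hk hal hax he (l := 1) (by decide))
      have h2 := h _ (bundle_not_mem_coinWindow hk hal hax he (l := 2) (by decide))
      simp only at h0 h1 h2
      rw [h0, h1, h2]
    · exact h0
  ext e
  simp only [Set.mem_sdiff]
  constructor
  · rintro ⟨⟨v, d, rfl, hopn⟩, heT⟩
    exact ⟨⟨v, d, rfl, (key v d heT).1 hopn⟩, heT⟩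
  · rintro ⟨⟨v, d, rfl, hopn⟩, heT⟩
    exact ⟨⟨v, d, rfl, (key v d heT).2 hopn⟩, heT⟩

/-- Coins agreeing ON the coin window of `W` give configurations agreeing on `W` (restatement of
`cfg_inter_eq_of_agree` for the restriction `S ∩ coinWindow k W`). -/
theorem cfg_inter_inter_coinWindow (k : ℕ) (W : Set (Sym2 (Site 2))) (S : Set Coin) :
    cfg k (S ∩ coinWindow k W) ∩ W = cfg k S ∩ W :=
  cfg_inter_eq_of_agree k fun i hi => by simp [hi]

/-- For an aligned block, the configuration off the block is a function of the coins off the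
block's coin window. -/
theorem cfg_sdiff_sdiff_coinWindow {k : ℕ} (hk : 0 < k) {j : Site 2} {R : ℕ}
    (hal : ∀ i, (k : ℤ) ∣ j i - R ∧ (k : ℤ) ∣ j i + R) (S : Set Coin) :
    cfg k (S \ coinWindow k (↑(blockPairs j R) : Set (Sym2 (Site 2)))) \ ↑(blockPairs j R) =
      cfg k S \ ↑(blockPairs j R) :=
  cfg_sdiff_eq_of_agree_off hk hal fun i hi => by simp [hi]

/-! ### Decoupling the inside and the outside of an aligned block under `M_k` -/

/-- **Decoupling identity.**  For an aligned block `T = blockPairs j R` and a bounded measurable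
`Φ`, `∫ Φ(ω ∩ T, ω ∖ T) dM_k(ω) = ∫∫ Φ(ω ∩ T, ω' ∖ T) dM_k(ω) dM_k(ω')`: under `M_k(ρ,c₀)` the
restriction of the configuration to the block and its restriction off the block are independent —
they are read off the disjoint coin sets `coinWindow k T` and its complement
(`cfg_inter_inter_coinWindow`, `cfg_sdiff_sdiff_coinWindow`), which are independent under the
coin product (`prodBernoulli_map_inter_sdiff_eq_prod`) — and Fubini. -/
theorem M_integral_eq_integral_integral {k : ℕ} (hk : 0 < k) (ρ c₀ : ℝ) {j : Site 2} {R : ℕ}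
    (hal : ∀ i, (k : ℤ) ∣ j i - R ∧ (k : ℤ) ∣ j i + R)
    {Φ : BondConfig (Site 2) × BondConfig (Site 2) → ℝ} (hΦm : Measurable Φ) {C : ℝ}
    (hΦC : ∀ z, |Φ z| ≤ C) :
    ∫ ω, Φ (ω ∩ ↑(blockPairs j R), ω \ ↑(blockPairs j R)) ∂(M k ρ c₀) =
      ∫ ω', ∫ ω, Φ (ω ∩ ↑(blockPairs j R), ω' \ ↑(blockPairs j R)) ∂(M k ρ c₀) ∂(M k ρ c₀) := by
  set T : Set (Sym2 (Site 2)) := ↑(blockPairs j R) with hT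
  set I : Set Coin := coinWindow k T with hI
  set P : Measure (Set Coin) := prodBernoulli (prm k ρ c₀) with hP
  haveI : IsProbabilityMeasure P := by rw [hP]; infer_instance
  have hM : M k ρ c₀ = P.map (cfg k) := rfl
  haveI : IsProbabilityMeasure (M k ρ c₀) := isProbabilityMeasure_M k ρ c₀
  have hX : Measurable fun ω : BondConfig (Site 2) => ω ∩ T := measurable_inter_right T
  have hY : Measurable fun ω : BondConfig (Site 2) => ω \ T := measurable_sdiff_right T
  have hXI : Measurable fun S : Set Coin => S ∩ I := measurable_inter_right I
  have hYI : Measurable fun S : Set Coin => S \ I := measurable_sdiff_right I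
  have hcfg := measurable_cfg k
  haveI : IsProbabilityMeasure (P.map fun S : Set Coin => S ∩ I) :=
    Measure.isProbabilityMeasure_map hXI.aemeasurable
  haveI : IsProbabilityMeasure (P.map fun S : Set Coin => S \ I) :=
    Measure.isProbabilityMeasure_map hYI.aemeasurable
  set Ψ : Set Coin × Set Coin → ℝ := fun z => Φ (cfg k z.1 ∩ T, cfg k z.2 \ T) with hΨ
  have hΨm : Measurable Ψ :=
    hΦm.comp ((hX.comp (hcfg.comp measurable_fst)).prodMk (hY.comp (hcfg.comp measurable_snd)))
  have hloc : ∀ S S' : Set Coin, Ψ (S ∩ I, S' \ I) = Φ (cfg k S ∩ T, cfg k S' \ T) := by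
    intro S S'
    simp only [hΨ]
    rw [cfg_inter_inter_coinWindow, cfg_sdiff_sdiff_coinWindow hk hal]
  -- (1) to the coin space
  have h1 : ∫ ω, Φ (ω ∩ T, ω \ T) ∂(M k ρ c₀) = ∫ S, Ψ (S ∩ I, S \ I) ∂P := by
    have hF : Measurable fun ω : BondConfig (Site 2) => Φ (ω ∩ T, ω \ T) := hΦm.comp (hX.prodMk hY)
    rw [hM, integral_map (f := fun ω : BondConfig (Site 2) => Φ (ω ∩ T, ω \ T)) hcfg.aemeasurable
      hF.aestronglyMeasurable]
    exact integral_congr_ae (ae_of_all _ fun S => (hloc S S).symm)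
  -- (2) the law of the pair is a product; Fubini
  have h2 : ∫ S, Ψ (S ∩ I, S \ I) ∂P =
      ∫ b, ∫ a, Ψ (a, b) ∂(P.map fun S : Set Coin => S ∩ I) ∂(P.map fun S : Set Coin => S \ I) := by
    rw [← integral_prod_symm Ψ, ← prodBernoulli_map_inter_sdiff_eq_prod (prm k ρ c₀) I,
      integral_map (hXI.prodMk hYI).aemeasurable hΨm.aestronglyMeasurable]
    exact Integrable.of_bound hΨm.aestronglyMeasurable C
      (ae_of_all _ fun z => by rw [Real.norm_eq_abs]; exact hΦC _)
  -- (3) back to configurations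
  have h3 : ∫ b, ∫ a, Ψ (a, b) ∂(P.map fun S : Set Coin => S ∩ I) ∂(P.map fun S : Set Coin => S \ I) =
      ∫ S', ∫ S, Ψ (S ∩ I, S' \ I) ∂P ∂P := by
    rw [integral_map hYI.aemeasurable (hΨm.stronglyMeasurable.integral_prod_left').aestronglyMeasurable]
    refine integral_congr_ae (ae_of_all _ fun S' => ?_)
    exact integral_map hXI.aemeasurable
      (hΨm.comp (measurable_id.prodMk measurable_const)).aestronglyMeasurable
  have h4 : ∀ S' : Set Coin, ∫ S, Ψ (S ∩ I, S' \ I) ∂P = ∫ ω, Φ (ω ∩ T, cfg k S' \ T) ∂(M k ρ c₀) := by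
    intro S'
    have hF : Measurable fun ω : BondConfig (Site 2) => Φ (ω ∩ T, cfg k S' \ T) :=
      hΦm.comp (hX.prodMk measurable_const)
    rw [hM, integral_map (f := fun ω : BondConfig (Site 2) => Φ (ω ∩ T, cfg k S' \ T))
      hcfg.aemeasurable hF.aestronglyMeasurable]
    exact integral_congr_ae (ae_of_all _ fun S => hloc S S')
  have h5 : ∫ S', ∫ ω, Φ (ω ∩ T, cfg k S' \ T) ∂(M k ρ c₀) ∂P =
      ∫ ω', ∫ ω, Φ (ω ∩ T, ω' \ T) ∂(M k ρ c₀) ∂(M k ρ c₀) := by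
    have hF : Measurable fun q : BondConfig (Site 2) × BondConfig (Site 2) => Φ (q.1 ∩ T, q.2 \ T) :=
      hΦm.comp ((hX.comp measurable_fst).prodMk (hY.comp measurable_snd))
    conv_rhs => rw [hM]
    rw [integral_map hcfg.aemeasurable (hF.stronglyMeasurable.integral_prod_left').aestronglyMeasurable]
  rw [h1, h2, h3, integral_congr_ae (ae_of_all _ h4), h5]

end Summit.CriticalPhenomena.CardyFormulaZ2.Theorems.CardySelfRefinement.FarField

end
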